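import Summits.QuantumFields.QCD.Theses.NestedDissectionSea
import Summits.QuantumFields.QCD.Theses.HeavyThresholdYMBridge
import Summits.QuantumFields.QCD.Theses.AdaptiveBlockFermions
import Literature.MathematicalPhysics.QuantumFieldTheory.ConstructiveQFTWave0OddRPProofs

/-!
# Line `cross-plane-hankel-rigidity` — skeleton for crux `RobustYangMills` (stmt-QuantumFields-13897)

Crux (shared, rev 4): `Summit.QuantumFields.QCD.Theses.NestedDissectionSea.RobustYangMills`
(= `HeavyThresholdYMBridge.RobustYangMills` = `AdaptiveBlockFermions.RobustYangMills`):
`∃ η₀ > 0, κ ≥ 0` such that for all scaling data `(a, L)`, every `N_f = 0` two-loop a.f. coupling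
sequence `β'` (`Λ' > 0`), every block scale `ℓ₀ > 0` and every family `W = (W_{k,S})` of D1
perturbations that is eventually ADMISSIBLE ((h1) lattice symmetric total, (h2) reflection positive,
(h3) `‖W_{k,S}‖_{b_k,κ} ≤ η₀ / max(1, afBeta 0 Λ' ℓ₀)`, (h4) range controlled): (i′) subsequential OS
limit `T` of the perturbed joint lattice Schwinger functions on `⁰𝒮`, (ii) non-trivial non-Gaussian
curvature, `T.HasMassGap Δ`, (iii′) uniform-in-`S` lattice clustering of `μ_{β'_k, W}` at rate `Δ`,
(iv) a `k`-uniform Lipschitz bound of the perturbed lattice Schwinger functions in the weighted norm.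

Idea card `Cruxes/RobustYangMills/Ideas/cross-plane-hankel-rigidity.md` (ideator 1), r1 triage panel
(TRIAGE-r1-1/2/3: `pass` ×3, merge-noted with `rp-cone-rigidity`), sharpened as the panel asked:

* THE LEVER. Exact reflection positivity (h2) is a CLOSED, face-rich condition (the OS form of the
  Wilson measure factorises through the slab at the plane; its null space contains every positive-
  time functional with vanishing conditional mean on that slab) and (h1) imposes it about every link
  plane of every axis on whole translation orbits: the first-order term of an admissible `W` must be
  of positive type across every plane — the cross-plane weights of a stacked family form a HANKEL
  matrix that must be positive semidefinite up to the dressing by conditional plaquette covariances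
  (`∝ h⁻⁸` off the diagonal) — so admissible totals are, decomposition-invariantly, positive Laplace /
  Stieltjes superpositions of cell-size positive-type functionals plus a vanishing coupling shift,
  with per-site strength `≲ η b_k⁻⁴ = η (a_k/ℓ₀)⁴` ((h3) spreads the block budget over `b_k⁴` cells;
  `κ > 0` prices the global polymers that (h4) lets through, Disproof §0b / triage r1-2 App. A).
  Consequence ("UV WASHING"): along an a.f. sequence the action direction of the crux is infrared-
  invisible — the perturbed Schwinger functions on `⁰𝒮` have the SAME subsequential limit `T` as the
  unperturbed ones (stub `SchwingerWashing`), and the uniform lattice gap survives with its own rate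
  (stub `WashedClustering`). The crux thereby collapses onto its `W ≡ 0` core (stub `YMCore` = the
  disprover's `WilsonConsequences` for every a.f. sequence: Clay `SU(3)` + `β`-universality, PROVED
  necessary by `Disproof.robustYangMills_imp_wilson`; re-proved below, §6 `ymCore_of_robustYangMills`,
  from the tree's odd-torus OS positivity) plus the response clause (iv).
* TRIAGE REPAIRS HONOURED. Washing is stated on TOTALS / measures only (never per activity:
  `W_cancel`, r1-3); every line stub takes `κ > 0` (r1-2 App. A); the response is stated on `⁰𝒮`
  smearings with the species side un-sup-normed (r1-2/3 on `axis-markov-response`); no crisp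
  "Hankel PSD" Prop is registered as a stub (r1-1 `NotHankelNecessity`, r1-2 Gaussian-chain remark,
  r1-3 (1): the exact necessity for the Wilson measure is the DRESSED, single-coupling, approximate
  condition) — the necessity lemma is a `--supports` target of `stub_schwingerWashing` (line card §Mechanism).
* CLAUSE (iv) FLAG (this seat; line card §Flag, NOTES ## FLAG). For `n ≥ 3` COINCIDENT smearings of
  the curvature species, (iv) as typed compares RAW moments whose disconnected part
  `3·Δ⟨Φ(f)⟩·Var Φ(f)` multiplies an `O(δ g_k²)` one-point response (specific heat `∂_β⟨s⟩ ≍ g⁴`,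
  per-site strength `δ a_k⁴/ℓ₀⁴` of the KP-`δ` coupling-shift direction) by the cutoff-divergent
  coincident variance `Var Φ(f) ≍ a_k⁻⁴` that `T.IsNontrivial r₃.curvature` forces (`c_k ≍ a_k⁻⁴g_k⁻²`):
  no `k`-uniform `C`. The believed-true content is (iv) on `⁰𝒮` (stub `OffDiagonalResponse`); the
  passage to all smearings is ISOLATED in stub `DiagonalExtension`, marked SUSPECT — it is where a
  restatement of (iv) (tenure) or a `-- Targets` near-miss `W-coincident` (cdisprove) must act; every
  line for this crux inherits it.

Five registered stubs `stub_*` (statements `YMCore`, `SchwingerWashing`, `WashedClustering`,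
`OffDiagonalResponse`, `DiagonalExtension`), the kernel-checked sorry-free composition
`RobustYangMills_of : YMCore → SchwingerWashing → WashedClustering → OffDiagonalResponse →
DiagonalExtension → RobustYangMills` (the crux BY NAME, `NestedDissectionSea` copy; `_of_primary` /
`_of_adaptiveBlockFermions` for the two verbatim copies), and `RobustYangMills_skeleton` /
`RobustYangMills_proof` (primary `HeavyThresholdYMBridge` name) / `_proof_adaptiveBlockFermions` from
the five stubs. Hardest line-specific stub: `stub_washedClustering` (stability
of the uniform lattice gap under asymptotically invisible but spatially extensive RP perturbations —
the card's tier C; no transfer-matrix perturbation theory applies, the route is rigidity ⇒ coupling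
drift + cell-local RP remainder ⇒ chessboard/`e^{±4η}` N-th-root bounds); hardest overall `stub_ymCore`
(⊇ Clay, shared by every line).

Disproof used (`Cruxes/RobustYangMills/Disproof.lean`, cdisprove cycle 1; no formal `_false_without_`):
§4 `robustYangMillsNoSmall_false` — (h3) is load-bearing: used quantitatively in `SchwingerWashing`,
`WashedClustering`, `OffDiagonalResponse` (per-site strength `η b_k⁻⁴`; the global mixture witnesses
of §4 / App. A are priced out only by `e^{κ|X|}` with `κ > 0`, which all three stubs demand);
§5 `robustYangMills_imp_wilson` — `stub_ymCore` is implied by the crux (no costume; §6 below);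
§0b `rangeControl_of_side_le` — (h4) is not used as a locality condition anywhere; §0c / landed
`Negative.isReflectionPositive_zero_odd` — `W ≡ 0` admissible (`admAt_zero`, §6). The landed Negative
extracts `Theorems/RobustYangMills/Negative/{GlobalActivity,MixtureWitness}` were `remote:stale:unbuilt`
on the farm at filing time, so §6 re-derives the two lemmas it needs from the tree
(`wilsonExpectation_oddReflectionPositive`) instead of importing them; no stub is an instance of a
statement they refute (their witnesses `globalPert … gOne/gMix` violate (h3), which Stubs 2–5 assume,
and Stub 1 is implied by the crux).

Sections: §1 vocabulary · §2 stub statements · §3 registered stubs · §4 glue (sorry-free) ·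
§5 composition `RobustYangMills_of` + `RobustYangMills_skeleton` · §6 negative-side checks.
-/

noncomputable section

open MeasureTheory Filter Topology
open scoped ENNReal ComplexOrder SchwartzMap
open Literature.MathematicalPhysics.QuantumLattice Literature.MathematicalPhysics.AQFT
  Literature.MathematicalPhysics.QuantumFieldTheory
open Summit.QuantumFields.QCD.Theses.NestedDissectionSea (RobustYangMills)

namespace Summit.QuantumFields.QCD.Cruxes.RobustYangMills.CrossPlaneHankelRigidity

/-! ## §1 Vocabulary (transparent abbreviations of the crux's own sub-terms) -/

/-- The gauge group of the crux. -/
abbrev SU3 : Type := ↥(Matrix.specialUnitaryGroup (Fin 3) ℂ)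

/-- Its fundamental representation (the crux's `ρ`). -/
abbrev ρ₃ : SU3 →* Matrix (Fin 3) (Fin 3) ℂ := fundamentalRep (Fin 3)

/-- The crux's `r₃ : LatticeRep SU3`. -/
abbrev r₃ : LatticeRep SU3 :=
  ⟨3, ρ₃, continuous_fundamentalRep _, fundamentalRep_injective _, fundamentalRep_mem_unitaryGroup⟩

/-- Families `W = (W_{k,S})` of D1 perturbations at block scale `b_k = ⌊ℓ₀ / a_k⌋` on the odd tori. -/
abbrev Family (a : ℕ → ℝ) (ℓ₀ : ℝ) : Type :=
  (k : ℕ) → (S : ℕ) → QuasiLocalGaugePerturbation 4 (2 * S + 1) SU3 ⌊ℓ₀ / a k⌋₊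

/-- **Admissibility at step `k`** — verbatim the crux's `AdmAt W k` with its parameters made explicit:
for all `S ≥ L_k`, (h1) the total is invariant under all lattice translations, the time reflection and
the axis permutations, (h2) `μ_{β'_k, W_{k,S}}` is reflection positive, (h3) `‖W_{k,S}‖_{b_k,κ} ≤ η`,
(h4) range control. -/
def AdmAt (κ η : ℝ) (a : ℕ → ℝ) (L : ℕ → ℕ) (β' : ℕ → ℝ) (ℓ₀ : ℝ) (W : Family a ℓ₀) (k : ℕ) : Prop :=
  ∀ S : ℕ, L k ≤ S →
    (∀ (v : Site 4 (2 * S + 1)) (U : GaugeConfig 4 (2 * S + 1) SU3),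
        (W k S).total (torusConfigShift v U) = (W k S).total U) ∧
    (∀ U : GaugeConfig 4 (2 * S + 1) SU3, (W k S).total (GaugeConfig.timeReflect U) = (W k S).total U) ∧
    (∀ (π : Equiv.Perm (Fin 4)) (U : GaugeConfig 4 (2 * S + 1) SU3),
        (W k S).total (fun e => U (e.1 ∘ π, π.symm e.2)) = (W k S).total U) ∧
    (W k S).IsReflectionPositive ρ₃ (β' k) ∧
    (W k S).NormLE κ η ∧
    (∀ X : Finset (Site 4 (2 * S + 1)), X ∈ polymers ⌊ℓ₀ / a k⌋₊ →
      (∃ U : GaugeConfig 4 (2 * S + 1) SU3, (W k S).act X U ≠ 0) →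
        ∀ y ∈ X, ∀ y' ∈ X, ∀ i : Fin 4,
          (y i - y' i).val ≤ ⌊ℓ₀ / a k⌋₊ * X.card ∨ (y' i - y i).val ≤ ⌊ℓ₀ / a k⌋₊ * X.card)

/-- The coupling-relative budget `η = η₀ / max(1, afBeta 0 Λ' ℓ₀)` of (h3). -/
abbrev budget (η₀ Λ' ℓ₀ : ℝ) : ℝ := η₀ / max 1 (afBeta 0 Λ' ℓ₀)

/-- Convergence of the UNPERTURBED joint lattice Schwinger functions along the subsequence `φ` to the
Schwinger functions of `T`, on `⁰𝒮` (verbatim the convergence clause of the disprover's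
`WilsonConsequences`). -/
def ConvAlong0 (sch : SpeciesScheme (YMSpecies SU3)) (φ : ℕ → ℕ) (T : OSData (YMSpecies SU3) 4) : Prop :=
  ∀ n : ℕ, n ≠ 0 → ∀ (σ : Fin n → YMSpecies SU3) (f : Fin n → 𝓢(EuclideanSpace ℝ (Fin 4), ℝ))
    (F : 𝓢((Fin n → EuclideanSpace ℝ (Fin 4)), ℂ)),
    IsTensorOf F (fun i => ofRealTest (f i)) → IsOffDiagonal F →
      Tendsto (fun j : ℕ => ((latticeSchwinger ρ₃ sch (fun s => s.F) (φ j) n σ f : ℝ) : ℂ))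
        atTop (𝓝 (T.schwinger n σ F))

/-- Convergence of the PERTURBED joint lattice Schwinger functions along `φ` to the Schwinger functions
of `T`, on `⁰𝒮` (verbatim clause (i′) of the crux). -/
def ConvAlongW (sch : SpeciesScheme (YMSpecies SU3)) {bs : ℕ → ℕ}
    (W : (k : ℕ) → QuasiLocalGaugePerturbation 4 (sch.side k) SU3 (bs k)) (φ : ℕ → ℕ)
    (T : OSData (YMSpecies SU3) 4) : Prop :=
  ∀ n : ℕ, n ≠ 0 → ∀ (σ : Fin n → YMSpecies SU3) (f : Fin n → 𝓢(EuclideanSpace ℝ (Fin 4), ℝ))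
    (F : 𝓢((Fin n → EuclideanSpace ℝ (Fin 4)), ℂ)),
    IsTensorOf F (fun i => ofRealTest (f i)) → IsOffDiagonal F →
      Tendsto (fun j : ℕ => ((perturbedLatticeSchwinger ρ₃ sch W (fun s => s.F) (φ j) n σ f : ℝ) : ℂ))
        atTop (𝓝 (T.schwinger n σ F))

/-- Uniform-in-`S` lattice clustering of the perturbed measures at rate `Δ` (verbatim clause (iii′)). -/
def ClusteringW (a : ℕ → ℝ) (L : ℕ → ℕ) (β' : ℕ → ℝ) {ℓ₀ : ℝ} (W : Family a ℓ₀) (Δ : ℝ) : Prop :=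
  ∀ A B : YMSpecies SU3, ∃ C : ℝ, ∀ᶠ k in atTop, ∀ S : ℕ, L k ≤ S → ∀ n : ℕ, n ≤ S →
    |(W k S).connectedCorr ρ₃ (β' k) A.F B.F n| ≤ C * Real.exp (-(Δ * (a k * n)))

/-- The Lipschitz clause (iv) of the crux, verbatim, for the family `W` and the renormalisations `(c, m)`. -/
def LipschitzClause (κ η : ℝ) (a : ℕ → ℝ) (L : ℕ → ℕ) (ha : ∀ k, 0 < a k)
    (ha₀ : Tendsto a atTop (𝓝 0)) (β' : ℕ → ℝ) (haL : Tendsto (fun k => a k * L k) atTop atTop)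
    (ℓ₀ : ℝ) (W : Family a ℓ₀) (c m : YMSpecies SU3 → ℕ → ℝ) : Prop :=
  ∀ (n : ℕ) (σ : Fin n → YMSpecies SU3) (f : Fin n → 𝓢(EuclideanSpace ℝ (Fin 4), ℝ)),
    ∃ C : ℝ, ∀ᶠ k in atTop, ∀ W' : Family a ℓ₀, AdmAt κ η a L β' ℓ₀ W' k → ∀ δ : ℝ, 0 ≤ δ →
      (∀ S : ℕ, L k ≤ S → (W k S - W' k S).NormLE κ δ) →
        |perturbedLatticeSchwinger ρ₃ (⟨a, ha, ha₀, β', L, haL, c, m⟩ : SpeciesScheme (YMSpecies SU3))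
            (fun k => W k (L k)) (fun s => s.F) k n σ f -
          perturbedLatticeSchwinger ρ₃ (⟨a, ha, ha₀, β', L, haL, c, m⟩ : SpeciesScheme (YMSpecies SU3))
            (fun k => W' k (L k)) (fun s => s.F) k n σ f| ≤ C * δ

/-- The Lipschitz clause restricted to `⁰𝒮`: `n ≠ 0` and smearings `f` whose tensor `f₁ ⊗ ⋯ ⊗ fₙ` is
off-diagonal (pairwise separated supports) — the part of (iv) the washing lever delivers. -/
def OffDiagLipschitz (κ η : ℝ) (a : ℕ → ℝ) (L : ℕ → ℕ) (ha : ∀ k, 0 < a k)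
    (ha₀ : Tendsto a atTop (𝓝 0)) (β' : ℕ → ℝ) (haL : Tendsto (fun k => a k * L k) atTop atTop)
    (ℓ₀ : ℝ) (W : Family a ℓ₀) (c m : YMSpecies SU3 → ℕ → ℝ) : Prop :=
  ∀ n : ℕ, n ≠ 0 → ∀ (σ : Fin n → YMSpecies SU3) (f : Fin n → 𝓢(EuclideanSpace ℝ (Fin 4), ℝ))
    (F : 𝓢((Fin n → EuclideanSpace ℝ (Fin 4)), ℂ)),
    IsTensorOf F (fun i => ofRealTest (f i)) → IsOffDiagonal F →
    ∃ C : ℝ, ∀ᶠ k in atTop, ∀ W' : Family a ℓ₀, AdmAt κ η a L β' ℓ₀ W' k → ∀ δ : ℝ, 0 ≤ δ →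
      (∀ S : ℕ, L k ≤ S → (W k S - W' k S).NormLE κ δ) →
        |perturbedLatticeSchwinger ρ₃ (⟨a, ha, ha₀, β', L, haL, c, m⟩ : SpeciesScheme (YMSpecies SU3))
            (fun k => W k (L k)) (fun s => s.F) k n σ f -
          perturbedLatticeSchwinger ρ₃ (⟨a, ha, ha₀, β', L, haL, c, m⟩ : SpeciesScheme (YMSpecies SU3))
            (fun k => W' k (L k)) (fun s => s.F) k n σ f| ≤ C * δ

/-- Normalisation of the witness renormalisations off the subsequence: `c_s(k) = 0` for `k ∉ range φ`
(there every perturbed `n`-point function, `n ≥ 1`, vanishes identically; WLOG for any witness, see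
`convAlong0_restrict`). -/
def OffSeqZero (φ : ℕ → ℕ) (c : YMSpecies SU3 → ℕ → ℝ) : Prop :=
  ∀ k : ℕ, (∀ j, φ j ≠ k) → ∀ s, c s k = 0

/-! ## §2 The five stub statements -/

/-- **Stub 1 — the `W ≡ 0` core (`YMCore`; ⊇ Clay `SU(3)` Yang–Mills + `β`-universality; shared by
every line).** For ALL scaling data and EVERY two-loop a.f. coupling sequence: a subsequential OS
continuum limit `T` of the joint lattice Schwinger functions of all gauge-invariant species of the pure
`SU(3)` Wilson theory on `⁰𝒮`, with non-trivial non-Gaussian curvature, `T.HasMassGap Δ` and the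
uniform lattice gap `HasLatticeMassGap` at the same `Δ > 0`. Verbatim the disprover's
`Disproof.WilsonConsequences a L ha ha₀ haL β'`, universally closed; the crux IMPLIES it
(`ymCore_of_robustYangMills`, §4) — necessary, not a costume. Inputs named on the item:
`HeavyThresholdYMBridge.YMLatticeGapAlongAFSequences` (stmt-8796), tree conjectures
`ClayYangMillsEuclideanGap{,Along}` (SU(3) case). -/
def YMCore : Prop :=
  ∀ (a : ℕ → ℝ) (L : ℕ → ℕ) (ha : ∀ k, 0 < a k) (ha₀ : Tendsto a atTop (𝓝 0))
    (haL : Tendsto (fun k => a k * L k) atTop atTop) (β' : ℕ → ℝ) (Λ' : ℝ),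
    0 < Λ' → Tendsto (fun k => β' k - afBeta 0 Λ' (a k)) atTop (𝓝 0) →
    ∃ φ : ℕ → ℕ, StrictMono φ ∧
      ∃ (c m : YMSpecies SU3 → ℕ → ℝ) (T : OSData (YMSpecies SU3) 4) (Δ : ℝ), 0 < Δ ∧
        ConvAlong0 ⟨a, ha, ha₀, β', L, haL, c, m⟩ φ T ∧
        T.IsNontrivial r₃.curvature ∧ T.IsNonGaussian r₃.curvature ∧ T.HasMassGap Δ ∧
        HasLatticeMassGap r₃ ⟨a, ha, ha₀, β', L, haL, c, m⟩ Δ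

/-- **Stub 2 — UV washing of the Schwinger functions (`SchwingerWashing`; the card's tier B, restated
on the MEASURE as triage r1-1 (ii) / r1-3 demanded).** There are `η₀ > 0` and `κ > 0` such that for
all a.f. data, every block scale and every eventually admissible family `W`: whenever the unperturbed
joint lattice Schwinger functions (with renormalisations `(c, m)`) converge on `⁰𝒮` along a
subsequence `φ` to the Schwinger functions of some OS data `T`, the `W`-perturbed ones converge along
the SAME `φ` to the SAME `T`. Mechanism: rigidity (admissible ⇒ vanishing coupling drift
`ε_k = O(η b_k⁻⁴)` plus positive-type cell-local remainders of per-site strength `η b_k⁻⁴` plus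
`e^{-κ((2S+1)/b_k)⁴}`-small global tails) and dimension counting against renormalisation
(`c_k ≍ a_k⁻⁴` × dilution `a_k⁴/ℓ₀⁴`; off-diagonal smearings only, so no coincident moments enter);
the only relevant/marginal gauge-invariant directions are `1` and `tr F²`. [size L–XL] -/
def SchwingerWashing : Prop :=
  ∃ η₀ : ℝ, 0 < η₀ ∧ ∃ κ : ℝ, 0 < κ ∧
    ∀ (a : ℕ → ℝ) (L : ℕ → ℕ) (ha : ∀ k, 0 < a k) (ha₀ : Tendsto a atTop (𝓝 0))
      (haL : Tendsto (fun k => a k * L k) atTop atTop) (β' : ℕ → ℝ) (Λ' : ℝ),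
      0 < Λ' → Tendsto (fun k => β' k - afBeta 0 Λ' (a k)) atTop (𝓝 0) →
      ∀ ℓ₀ : ℝ, 0 < ℓ₀ → ∀ W : Family a ℓ₀,
        (∀ᶠ k in atTop, AdmAt κ (budget η₀ Λ' ℓ₀) a L β' ℓ₀ W k) →
        ∀ (φ : ℕ → ℕ) (c m : YMSpecies SU3 → ℕ → ℝ) (T : OSData (YMSpecies SU3) 4),
          StrictMono φ →
          ConvAlong0 ⟨a, ha, ha₀, β', L, haL, c, m⟩ φ T →
          ConvAlongW ⟨a, ha, ha₀, β', L, haL, c, m⟩ (fun k => W k (L k)) φ T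

/-- **Stub 3 — washed stability of the uniform lattice gap (`WashedClustering`; the card's tier C,
with `κ > 0` as triage r1-2 App. A requires).** There are `η₀ > 0`, `κ > 0` such that for all scaling
data `(a, L)` and `Λ' > 0`: IF the pure Wilson theory has a uniform lattice gap along EVERY a.f.
coupling sequence `β''` for `Λ'` (the core's `HasLatticeMassGap`, rate depending on the sequence),
THEN along every a.f. `β'`, every eventually admissible family has uniform-in-`S` clustering of its
perturbed measures at SOME rate `Δ_W > 0`. (The hypothesis covers the coupling-drift part of `W`,
again a.f.; the cell-local positive-type remainder of relative strength `η a_k⁴/ℓ₀⁴` and the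
block-coherent large deviations of probability `e^{-c b_k⁴ β'_k}` are the stub's own work —
chessboard / `N`-th-root quantities are `e^{±4η}`-stable over the cone, uniformly in `k, S`.) [size XL] -/
def WashedClustering : Prop :=
  ∃ η₀ : ℝ, 0 < η₀ ∧ ∃ κ : ℝ, 0 < κ ∧
    ∀ (a : ℕ → ℝ) (L : ℕ → ℕ) (ha : ∀ k, 0 < a k) (ha₀ : Tendsto a atTop (𝓝 0))
      (haL : Tendsto (fun k => a k * L k) atTop atTop) (Λ' : ℝ), 0 < Λ' →
      (∀ β'' : ℕ → ℝ, Tendsto (fun k => β'' k - afBeta 0 Λ' (a k)) atTop (𝓝 0) →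
        ∃ (c m : YMSpecies SU3 → ℕ → ℝ) (Δ : ℝ), 0 < Δ ∧
          HasLatticeMassGap r₃ ⟨a, ha, ha₀, β'', L, haL, c, m⟩ Δ) →
      ∀ β' : ℕ → ℝ, Tendsto (fun k => β' k - afBeta 0 Λ' (a k)) atTop (𝓝 0) →
      ∀ ℓ₀ : ℝ, 0 < ℓ₀ → ∀ W : Family a ℓ₀,
        (∀ᶠ k in atTop, AdmAt κ (budget η₀ Λ' ℓ₀) a L β' ℓ₀ W k) →
        ∃ Δ : ℝ, 0 < Δ ∧ ClusteringW a L β' W Δ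

/-- **Stub 4 — Lipschitz response on `⁰𝒮` (`OffDiagonalResponse`; clause (iv) where it is believed).**
There are `η₀ > 0`, `κ > 0` such that for all a.f. data, `ℓ₀ > 0` and every eventually admissible
`W`, and for every washed witness `(φ, c, m, T)` (unperturbed AND perturbed Schwinger functions
converge to `T` along `φ`; renormalisations normalised to `0` off `range φ`) whose perturbed measures
cluster uniformly at some rate `Δ > 0`: for each `n ≥ 1`, species string `σ` and OFF-DIAGONAL
smearing `f` there is a `k`-uniform `C` with `|S_k(W) - S_k(W')| ≤ C δ` whenever `W'` is admissible at
step `k` and `‖W_{k,S} - W'_{k,S}‖_{b_k,κ} ≤ δ` for all `S ≥ L_k`. Mechanism: an admissible direction of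
KP-size `δ` is a coupling-drift response — per-site strength `δ (a_k/ℓ₀)⁴` against `∑_z ⟨∏Φ ; s_z⟩`,
dimension 4 against dimension 4 (triage r1-2 App. C) — plus Davydov/`L²`-side covariance bounds from
the clustering hypothesis for the cell-local remainder; interpolation runs inside the RP-good sub-cone
(the RP cone is not star-shaped, ideator-2 §E). [size L] -/
def OffDiagonalResponse : Prop :=
  ∃ η₀ : ℝ, 0 < η₀ ∧ ∃ κ : ℝ, 0 < κ ∧
    ∀ (a : ℕ → ℝ) (L : ℕ → ℕ) (ha : ∀ k, 0 < a k) (ha₀ : Tendsto a atTop (𝓝 0))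
      (haL : Tendsto (fun k => a k * L k) atTop atTop) (β' : ℕ → ℝ) (Λ' : ℝ),
      0 < Λ' → Tendsto (fun k => β' k - afBeta 0 Λ' (a k)) atTop (𝓝 0) →
      ∀ ℓ₀ : ℝ, 0 < ℓ₀ → ∀ W : Family a ℓ₀,
        (∀ᶠ k in atTop, AdmAt κ (budget η₀ Λ' ℓ₀) a L β' ℓ₀ W k) →
        ∀ (φ : ℕ → ℕ) (c m : YMSpecies SU3 → ℕ → ℝ) (T : OSData (YMSpecies SU3) 4) (Δ : ℝ),
          StrictMono φ → OffSeqZero φ c →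
          ConvAlong0 ⟨a, ha, ha₀, β', L, haL, c, m⟩ φ T →
          ConvAlongW ⟨a, ha, ha₀, β', L, haL, c, m⟩ (fun k => W k (L k)) φ T →
          0 < Δ → ClusteringW a L β' W Δ →
          OffDiagLipschitz κ (budget η₀ Λ' ℓ₀) a L ha ha₀ β' haL ℓ₀ W c m

/-- **Stub 5 — extension of the response bound from `⁰𝒮` to ALL smearings (`DiagonalExtension`).
SUSPECT — this stub isolates the clause-(iv) defect of the crux (rev 4) and is filed so that the
defect has a name; do not staff it before (iv) is restated or the flag is refuted.** For every `κ, η`,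
all a.f. data, every eventually admissible `W` and every washed witness as in Stub 4 with non-trivial
curvature: the off-diagonal Lipschitz bound implies the verbatim clause (iv) (all `n`, incl. `n = 0`,
and coincident smearings). WHY SUSPECT: for `n = 3`, `σ ≡` curvature, `f₁ = f₂ = f₃ = f`, `W ≡ 0` and
`W'` the admissible KP-`δ` coupling-shift direction (`total = ε S_W`, `ε = θ δ / b_k⁴`),
`⟨Φ(f)³⟩_{W'} - ⟨Φ(f)³⟩_W = Δκ₃ + 3 Δμ · Var' + 3 μ · ΔVar + Δ(μ³)` with `Δκ₃, ΔVar, Δ(μ³) = O(δ g_k²)`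
but `Δμ = c_k ∫f · ε ∂_β⟨s⟩ ≍ δ g_k²` (specific heat `∂_β⟨s⟩ ≍ g⁴ > 0`) times
`Var Φ(f) ≍ c_k² a_k⁴ ‖f‖₂² g⁴ ≍ a_k⁻⁴` (`c_k ≍ a_k⁻⁴ g_k⁻²` forced by non-triviality of the limit
two-point function) — `≍ δ g_k² a_k⁻⁴`, unbounded in `k`. Not Lean-refutable today (needs the
weak-coupling decay `|⟨s_x ; s_y⟩| ≲ a⁸` at physical separation to pin `c_k`). Repairs that make this
stub TRUE and keep the line: restrict (iv) to `⁰𝒮` smearings (as (i′) already is), or to bounded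
un-renormalised cylinder observables, or to truncated functions. [size: M if (iv) is restated; else
believed FALSE] -/
def DiagonalExtension : Prop :=
  ∀ (κ η : ℝ) (a : ℕ → ℝ) (L : ℕ → ℕ) (ha : ∀ k, 0 < a k) (ha₀ : Tendsto a atTop (𝓝 0))
    (haL : Tendsto (fun k => a k * L k) atTop atTop) (β' : ℕ → ℝ) (Λ' : ℝ),
    0 < Λ' → Tendsto (fun k => β' k - afBeta 0 Λ' (a k)) atTop (𝓝 0) →
    ∀ ℓ₀ : ℝ, 0 < ℓ₀ → ∀ W : Family a ℓ₀, (∀ᶠ k in atTop, AdmAt κ η a L β' ℓ₀ W k) →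
      ∀ (φ : ℕ → ℕ) (c m : YMSpecies SU3 → ℕ → ℝ) (T : OSData (YMSpecies SU3) 4) (Δ : ℝ),
        StrictMono φ → OffSeqZero φ c →
        ConvAlong0 ⟨a, ha, ha₀, β', L, haL, c, m⟩ φ T →
        ConvAlongW ⟨a, ha, ha₀, β', L, haL, c, m⟩ (fun k => W k (L k)) φ T →
        T.IsNontrivial r₃.curvature → 0 < Δ → ClusteringW a L β' W Δ →
        OffDiagLipschitz κ η a L ha ha₀ β' haL ℓ₀ W c m →
        LipschitzClause κ η a L ha ha₀ β' haL ℓ₀ W c m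

/-! ## §3 Registered stubs -/

/-- Stub 1 (`YMCore`): the `W ≡ 0` core — Clay `SU(3)` + `β`-universality along every a.f. sequence. -/
theorem stub_ymCore : YMCore := by
  sorry

/-- Stub 2 (`SchwingerWashing`): admissible perturbations do not move the OS limit on `⁰𝒮`. -/
theorem stub_schwingerWashing : SchwingerWashing := by
  sorry

/-- Stub 3 (`WashedClustering`): the uniform lattice gap survives admissible perturbations (own rate). -/
theorem stub_washedClustering : WashedClustering := by
  sorry

/-- Stub 4 (`OffDiagonalResponse`): `k`-uniform Lipschitz response of the Schwinger functions on `⁰𝒮`. -/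
theorem stub_offDiagonalResponse : OffDiagonalResponse := by
  sorry

/-- Stub 5 (`DiagonalExtension`, SUSPECT): from `⁰𝒮` to all smearings — carries the clause-(iv) flag. -/
theorem stub_diagonalExtension : DiagonalExtension := by
  sorry

/-! ### Name-keyed aliases of the five statements (hypotheses of the composition)

`Registered.stub_X` is statement `X` under the registered stub's short name, so that the native skeleton
audit (`#h21_check_skeleton`: hypotheses admissible iff registered obligations / declared stubs BY NAME)
accepts `RobustYangMills_of : Registered.stub_ymCore → … → RobustYangMills` (device of
`Cruxes/NoisyFourier/Lines/half-conserved-witness.lean`). -/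
namespace Registered

/-- Alias of `YMCore` keyed by the registered stub name. -/
abbrev stub_ymCore : Prop := YMCore
/-- Alias of `SchwingerWashing` keyed by the registered stub name. -/
abbrev stub_schwingerWashing : Prop := SchwingerWashing
/-- Alias of `WashedClustering` keyed by the registered stub name. -/
abbrev stub_washedClustering : Prop := WashedClustering
/-- Alias of `OffDiagonalResponse` keyed by the registered stub name. -/
abbrev stub_offDiagonalResponse : Prop := OffDiagonalResponse
/-- Alias of `DiagonalExtension` keyed by the registered stub name. -/
abbrev stub_diagonalExtension : Prop := DiagonalExtension

end Registered


/-! ## §4 Glue (sorry-free): monotonicity in `(κ, η, Δ)` and the off-subsequence normalisation -/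

section Glue

variable {a : ℕ → ℝ} {L : ℕ → ℕ} {β' : ℕ → ℝ} {ℓ₀ : ℝ}

/-- Admissibility is antitone in `κ` and monotone in `η` (only (h3) moves: `NormLE.anti`/`.mono`). -/
theorem admAt_mono {κ κ' η η' : ℝ} (hκ : κ' ≤ κ) (hη : η ≤ η') {W : Family a ℓ₀} {k : ℕ}
    (h : AdmAt κ η a L β' ℓ₀ W k) : AdmAt κ' η' a L β' ℓ₀ W k := fun S hS =>
  let ⟨h1, h2, h3, h4, h5, h6⟩ := h S hS
  ⟨h1, h2, h3, h4, (h5.anti hκ).mono hη, h6⟩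

/-- Eventual admissibility is antitone in `κ` and monotone in `η`. -/
theorem eventually_admAt_mono {κ κ' η η' : ℝ} (hκ : κ' ≤ κ) (hη : η ≤ η') {W : Family a ℓ₀}
    (h : ∀ᶠ k in atTop, AdmAt κ η a L β' ℓ₀ W k) : ∀ᶠ k in atTop, AdmAt κ' η' a L β' ℓ₀ W k :=
  h.mono fun _ hk => admAt_mono hκ hη hk

/-- The coupling-relative budget is monotone in `η₀`. -/
theorem budget_mono {η₀ η₀' : ℝ} (h : η₀ ≤ η₀') (Λ' ℓ₀ : ℝ) : budget η₀ Λ' ℓ₀ ≤ budget η₀' Λ' ℓ₀ :=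
  div_le_div_of_nonneg_right h (lt_of_lt_of_le zero_lt_one (le_max_left _ _)).le

/-- `HasMassGap` is antitone in the rate. -/
theorem hasMassGap_anti {T : OSData (YMSpecies SU3) 4} {Δ Δ' : ℝ} (h : T.HasMassGap Δ)
    (hle : Δ' ≤ Δ) : T.HasMassGap Δ' := by
  intro n m k k' F G hF hG
  obtain ⟨C, hC⟩ := h n m k k' F G hF hG
  refine ⟨max C 0, fun t ht H hH => (hC t ht H hH).trans ?_⟩
  calc C * Real.exp (-Δ * t) ≤ max C 0 * Real.exp (-Δ * t) :=
        mul_le_mul_of_nonneg_right (le_max_left _ _) (Real.exp_pos _).le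
    _ ≤ max C 0 * Real.exp (-Δ' * t) :=
        mul_le_mul_of_nonneg_left (Real.exp_le_exp.2 (by nlinarith)) (le_max_right _ _)

/-- Uniform lattice clustering is antitone in the rate. -/
theorem clusteringW_anti {W : Family a ℓ₀} {Δ Δ' : ℝ} (ha : ∀ k, 0 < a k)
    (h : ClusteringW a L β' W Δ) (hle : Δ' ≤ Δ) : ClusteringW a L β' W Δ' := by
  intro A B
  obtain ⟨C, hC⟩ := h A B
  refine ⟨max C 0, ?_⟩
  filter_upwards [hC] with k hk S hS n hn
  refine (hk S hS n hn).trans ?_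
  have ht : 0 ≤ a k * n := mul_nonneg (ha k).le (Nat.cast_nonneg n)
  calc C * Real.exp (-(Δ * (a k * n))) ≤ max C 0 * Real.exp (-(Δ * (a k * n))) :=
        mul_le_mul_of_nonneg_right (le_max_left _ _) (Real.exp_pos _).le
    _ ≤ max C 0 * Real.exp (-(Δ' * (a k * n))) :=
        mul_le_mul_of_nonneg_left (Real.exp_le_exp.2 (by nlinarith)) (le_max_right _ _)

/-- The Lipschitz clause is monotone in `κ` and antitone in `η` (admissibility of `W'` and the
`NormLE κ δ` hypothesis sit in contravariant position). -/
theorem lipschitzClause_mono {κ κ' η η' : ℝ} (hκ : κ ≤ κ') (hη : η' ≤ η) {ha : ∀ k, 0 < a k}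
    {ha₀ : Tendsto a atTop (𝓝 0)} {haL : Tendsto (fun k => a k * L k) atTop atTop}
    {W : Family a ℓ₀} {c m : YMSpecies SU3 → ℕ → ℝ}
    (h : LipschitzClause κ η a L ha ha₀ β' haL ℓ₀ W c m) :
    LipschitzClause κ' η' a L ha ha₀ β' haL ℓ₀ W c m := by
  intro n σ f
  obtain ⟨C, hC⟩ := h n σ f
  refine ⟨C, ?_⟩
  filter_upwards [hC] with k hk W' hW' δ hδ hdist
  exact hk W' (admAt_mono hκ hη hW') δ hδ fun S hS => (hdist S hS).anti hκ

open Classical in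
/-- The renormalisation constants restricted to the subsequence `φ` (zero elsewhere). -/
def restrictC (φ : ℕ → ℕ) (c : YMSpecies SU3 → ℕ → ℝ) : YMSpecies SU3 → ℕ → ℝ :=
  fun s k => if ∃ j, φ j = k then c s k else 0

theorem restrictC_seq (φ : ℕ → ℕ) (c : YMSpecies SU3 → ℕ → ℝ) (s : YMSpecies SU3) (j : ℕ) :
    restrictC φ c s (φ j) = c s (φ j) := by
  simp only [restrictC]
  rw [if_pos ⟨j, rfl⟩]

theorem offSeqZero_restrictC (φ : ℕ → ℕ) (c : YMSpecies SU3 → ℕ → ℝ) : OffSeqZero φ (restrictC φ c) := by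
  intro k hk s
  simp only [restrictC]
  rw [if_neg]
  rintro ⟨j, hj⟩
  exact hk j hj

/-- Restricting `c` to the subsequence does not change the lattice Schwinger functions ON the subsequence. -/
theorem latticeSchwinger_restrictC (ha : ∀ k, 0 < a k) (ha₀ : Tendsto a atTop (𝓝 0))
    (haL : Tendsto (fun k => a k * L k) atTop atTop) (c m : YMSpecies SU3 → ℕ → ℝ) (φ : ℕ → ℕ)
    (j n : ℕ) (σ : Fin n → YMSpecies SU3) (f : Fin n → 𝓢(EuclideanSpace ℝ (Fin 4), ℝ)) :
    latticeSchwinger ρ₃ (⟨a, ha, ha₀, β', L, haL, restrictC φ c, m⟩ : SpeciesScheme (YMSpecies SU3))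
        (fun s => s.F) (φ j) n σ f =
      latticeSchwinger ρ₃ (⟨a, ha, ha₀, β', L, haL, c, m⟩ : SpeciesScheme (YMSpecies SU3))
        (fun s => s.F) (φ j) n σ f := by
  dsimp only [latticeSchwinger, SpeciesScheme.side]
  simp only [restrictC_seq]
  -- the two sides now differ only in the (proof-irrelevant) `NeZero (sch.side _)` instance terms
  rfl

/-- Hence `ConvAlong0` survives the restriction (WLOG normalisation of any core witness). -/
theorem convAlong0_restrictC {ha : ∀ k, 0 < a k} {ha₀ : Tendsto a atTop (𝓝 0)}
    {haL : Tendsto (fun k => a k * L k) atTop atTop} {c m : YMSpecies SU3 → ℕ → ℝ} {φ : ℕ → ℕ}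
    {T : OSData (YMSpecies SU3) 4} (h : ConvAlong0 ⟨a, ha, ha₀, β', L, haL, c, m⟩ φ T) :
    ConvAlong0 ⟨a, ha, ha₀, β', L, haL, restrictC φ c, m⟩ φ T := by
  intro n hn σ f F hF hF'
  exact (h n hn σ f F hF hF').congr fun j => by rw [latticeSchwinger_restrictC]

/-- `HasLatticeMassGap` does not see the renormalisation constants at all. -/
theorem hasLatticeMassGap_restrictC {ha : ∀ k, 0 < a k} {ha₀ : Tendsto a atTop (𝓝 0)}
    {haL : Tendsto (fun k => a k * L k) atTop atTop} {c m : YMSpecies SU3 → ℕ → ℝ} {Δ : ℝ}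
    (φ : ℕ → ℕ) (h : HasLatticeMassGap r₃ ⟨a, ha, ha₀, β', L, haL, c, m⟩ Δ) :
    HasLatticeMassGap r₃ ⟨a, ha, ha₀, β', L, haL, restrictC φ c, m⟩ Δ :=
  fun A B => h A B

end Glue

/-! ## §5 The composition: the crux BY NAME from the five stubs (kernel-checked, no `sorry`) -/

/-- **Composition.** `YMCore → SchwingerWashing → WashedClustering → OffDiagonalResponse →
DiagonalExtension → RobustYangMills`. Universal constants: `η₀ := min` of the three line budgets,
`κ := max` of the three decay rates (admissibility is then admissibility for each stub; clause (iv)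
only weakens when `κ` grows / `η` shrinks: `lipschitzClause_mono`). Given a.f. data and an eventually
admissible `W`: the core witness `(φ, c, m, T, Δ₀)` at `β'` (renormalisations WLOG restricted to
`range φ`), washing transports its convergence to the perturbed functions with the SAME `T` — so
(i′), (ii) and `T.HasMassGap` are inherited; washed clustering (fed the core's lattice gap along EVERY
a.f. sequence) gives (iii′) at a rate `Δ₁`; `Δ := min Δ₀ Δ₁` by antitonicity; (iv) = off-diagonal
response + the (suspect) diagonal extension at `(κ₄, η₄)`, weakened to `(κ, η)`. -/
theorem RobustYangMills_of (h₁ : Registered.stub_ymCore) (h₂ : Registered.stub_schwingerWashing)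
    (h₃ : Registered.stub_washedClustering) (h₄ : Registered.stub_offDiagonalResponse)
    (h₅ : Registered.stub_diagonalExtension) : RobustYangMills := by
  obtain ⟨η₂, hη₂, κ₂, hκ₂, H₂⟩ := h₂
  obtain ⟨η₃, hη₃, κ₃, hκ₃, H₃⟩ := h₃
  obtain ⟨η₄, hη₄, κ₄, hκ₄, H₄⟩ := h₄
  refine ⟨min η₂ (min η₃ η₄), lt_min hη₂ (lt_min hη₃ hη₄), max κ₂ (max κ₃ κ₄),
    hκ₂.le.trans (le_max_left _ _), ?_⟩
  intro a L ha ha₀ haL β' Λ' hΛ' hβ' ℓ₀ hℓ₀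
  dsimp only
  intro W hW
  -- admissibility at the crux's constants, then at each stub's constants
  have hW' : ∀ᶠ k in atTop,
      AdmAt (max κ₂ (max κ₃ κ₄)) (budget (min η₂ (min η₃ η₄)) Λ' ℓ₀) a L β' ℓ₀ W k := hW
  have hb₂ : budget (min η₂ (min η₃ η₄)) Λ' ℓ₀ ≤ budget η₂ Λ' ℓ₀ :=
    budget_mono (min_le_left _ _) _ _
  have hb₃ : budget (min η₂ (min η₃ η₄)) Λ' ℓ₀ ≤ budget η₃ Λ' ℓ₀ :=
    budget_mono ((min_le_right _ _).trans (min_le_left _ _)) _ _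
  have hb₄ : budget (min η₂ (min η₃ η₄)) Λ' ℓ₀ ≤ budget η₄ Λ' ℓ₀ :=
    budget_mono ((min_le_right _ _).trans (min_le_right _ _)) _ _
  have hk₂ : κ₂ ≤ max κ₂ (max κ₃ κ₄) := le_max_left _ _
  have hk₃ : κ₃ ≤ max κ₂ (max κ₃ κ₄) := (le_max_left _ _).trans (le_max_right _ _)
  have hk₄ : κ₄ ≤ max κ₂ (max κ₃ κ₄) := (le_max_right _ _).trans (le_max_right _ _)
  have hW₂ := eventually_admAt_mono hk₂ hb₂ hW'
  have hW₃ := eventually_admAt_mono hk₃ hb₃ hW'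
  have hW₄ := eventually_admAt_mono hk₄ hb₄ hW'
  -- the `W ≡ 0` core at `β'`, renormalisations restricted to the subsequence
  obtain ⟨φ, hφ, c, m, T, Δ₀, hΔ₀, hconv, hnt, hng, hgapT, hgapL⟩ := h₁ a L ha ha₀ haL β' Λ' hΛ' hβ'
  have hoff : OffSeqZero φ (restrictC φ c) := offSeqZero_restrictC φ c
  have hconv' : ConvAlong0 ⟨a, ha, ha₀, β', L, haL, restrictC φ c, m⟩ φ T := convAlong0_restrictC hconv
  have hgapL' : HasLatticeMassGap r₃ ⟨a, ha, ha₀, β', L, haL, restrictC φ c, m⟩ Δ₀ :=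
    hasLatticeMassGap_restrictC φ hgapL
  -- washing: the perturbed functions converge along the same `φ` to the same `T`
  have hconvW : ConvAlongW ⟨a, ha, ha₀, β', L, haL, restrictC φ c, m⟩ (fun k => W k (L k)) φ T :=
    H₂ a L ha ha₀ haL β' Λ' hΛ' hβ' ℓ₀ hℓ₀ W hW₂ φ (restrictC φ c) m T hφ hconv'
  -- washed clustering, fed the core's lattice gap along every a.f. sequence
  obtain ⟨Δ₁, hΔ₁, hcl⟩ := H₃ a L ha ha₀ haL Λ' hΛ'
    (fun β'' hβ'' => by
      obtain ⟨-, -, c'', m'', -, Δ'', hΔ'', -, -, -, -, hgap''⟩ := h₁ a L ha ha₀ haL β'' Λ' hΛ' hβ''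
      exact ⟨c'', m'', Δ'', hΔ'', hgap''⟩)
    β' hβ' ℓ₀ hℓ₀ W hW₃
  -- response on ⁰𝒮, its (suspect) extension, weakened to the crux's constants
  have hoffd : OffDiagLipschitz κ₄ (budget η₄ Λ' ℓ₀) a L ha ha₀ β' haL ℓ₀ W (restrictC φ c) m :=
    H₄ a L ha ha₀ haL β' Λ' hΛ' hβ' ℓ₀ hℓ₀ W hW₄ φ (restrictC φ c) m T Δ₁ hφ hoff hconv' hconvW hΔ₁ hcl
  have hlip₄ : LipschitzClause κ₄ (budget η₄ Λ' ℓ₀) a L ha ha₀ β' haL ℓ₀ W (restrictC φ c) m :=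
    h₅ κ₄ (budget η₄ Λ' ℓ₀) a L ha ha₀ haL β' Λ' hΛ' hβ' ℓ₀ hℓ₀ W hW₄ φ (restrictC φ c) m T Δ₁ hφ
      hoff hconv' hconvW hnt hΔ₁ hcl hoffd
  have hlip : LipschitzClause (max κ₂ (max κ₃ κ₄)) (budget (min η₂ (min η₃ η₄)) Λ' ℓ₀) a L ha ha₀
      β' haL ℓ₀ W (restrictC φ c) m :=
    lipschitzClause_mono hk₄ hb₄ hlip₄
  -- assemble the crux's witness
  exact ⟨φ, hφ, restrictC φ c, m, T, min Δ₀ Δ₁, lt_min hΔ₀ hΔ₁, hconvW, hnt, hng,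
    hasMassGap_anti hgapT (min_le_left _ _), clusteringW_anti ha hcl (min_le_right _ _), hlip⟩

/-- **The skeleton: the crux BY NAME** (its only `sorry`s are the five registered stubs'; the
composition `RobustYangMills_of` is sorry-free). -/
theorem RobustYangMills_skeleton : RobustYangMills :=
  RobustYangMills_of stub_ymCore stub_schwingerWashing stub_washedClustering
    stub_offDiagonalResponse stub_diagonalExtension

/-! ### The shared crux under its other two route names (item stmt-QuantumFields-13897 was filed by
`HeavyThresholdYMBridge`, which the gate treats as primary; the three route copies are verbatim and
definitionally equal, so the same composition serves all three). -/

/-- **The skeleton under the primary name** (the hypothesis-free `<Crux>_proof` the skeleton check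
reads; its `sorry`-cone is exactly the five registered stubs): `HeavyThresholdYMBridge.RobustYangMills`. -/
theorem RobustYangMills_proof : Summit.QuantumFields.QCD.Theses.HeavyThresholdYMBridge.RobustYangMills :=
  RobustYangMills_of stub_ymCore stub_schwingerWashing stub_washedClustering
    stub_offDiagonalResponse stub_diagonalExtension

/-- The skeleton under the third name, `AdaptiveBlockFermions.RobustYangMills`. -/
theorem RobustYangMills_proof_adaptiveBlockFermions :
    Summit.QuantumFields.QCD.Theses.AdaptiveBlockFermions.RobustYangMills :=
  RobustYangMills_of stub_ymCore stub_schwingerWashing stub_washedClustering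
    stub_offDiagonalResponse stub_diagonalExtension

/-- Composition, concluding the PRIMARY copy `HeavyThresholdYMBridge.RobustYangMills` (sorry-free). -/
theorem RobustYangMills_of_primary (h₁ : Registered.stub_ymCore)
    (h₂ : Registered.stub_schwingerWashing) (h₃ : Registered.stub_washedClustering)
    (h₄ : Registered.stub_offDiagonalResponse) (h₅ : Registered.stub_diagonalExtension) :
    Summit.QuantumFields.QCD.Theses.HeavyThresholdYMBridge.RobustYangMills :=
  RobustYangMills_of h₁ h₂ h₃ h₄ h₅

/-- Composition, concluding the copy `AdaptiveBlockFermions.RobustYangMills` (sorry-free). -/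
theorem RobustYangMills_of_adaptiveBlockFermions (h₁ : Registered.stub_ymCore)
    (h₂ : Registered.stub_schwingerWashing) (h₃ : Registered.stub_washedClustering)
    (h₄ : Registered.stub_offDiagonalResponse) (h₅ : Registered.stub_diagonalExtension) :
    Summit.QuantumFields.QCD.Theses.AdaptiveBlockFermions.RobustYangMills :=
  RobustYangMills_of h₁ h₂ h₃ h₄ h₅

/-! ## §6 Negative-side checks (sorry-free): `W ≡ 0` is admissible for every `κ`, `η ≥ 0`, and the
crux IMPLIES Stub 1 (`YMCore` is necessary — verbatim the content of `Disproof.robustYangMills_imp_wilson`,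
re-derived here from the tree's odd-torus Osterwalder–Seiler positivity because the landed extracts
`Theorems/RobustYangMills/Negative/*` were not yet built on the farm at filing time). -/

section NegativeChecks

/-- The pure-gauge two-loop profile diverges along every scaling sequence (copy of Disproof §5). -/
theorem tendsto_afBeta_zero_atTop {a : ℕ → ℝ} (ha : ∀ k, 0 < a k)
    (ha₀ : Tendsto a atTop (𝓝 0)) {Λ : ℝ} (hΛ : 0 < Λ) :
    Tendsto (fun k => afBeta 0 Λ (a k)) atTop atTop := by
  have hu : Tendsto (fun k => 1 / (a k ^ 2 * Λ ^ 2)) atTop atTop := by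
    simp only [one_div]
    refine tendsto_inv_nhdsGT_zero.comp ?_
    refine tendsto_nhdsWithin_iff.2 ⟨?_, Eventually.of_forall fun k => ?_⟩
    · simpa using (ha₀.pow 2).mul_const (Λ ^ 2)
    · exact Set.mem_Ioi.2 (by have := ha k; positivity)
  have hlog := Real.tendsto_log_atTop.comp hu
  have hb0 : 0 < betaCoeff₀ 0 := by unfold betaCoeff₀; norm_num; positivity
  have hb1 : 0 < betaCoeff₁ 0 := by unfold betaCoeff₁; norm_num; positivity
  have hmain : Tendsto (fun k => 2 * betaCoeff₀ 0 * Real.log (1 / (a k ^ 2 * Λ ^ 2))) atTop atTop :=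
    Tendsto.const_mul_atTop (by positivity) hlog
  refine tendsto_atTop_mono' atTop ?_ hmain
  filter_upwards [hlog.eventually_ge_atTop 1] with k hk
  unfold afBeta
  have hll : 0 ≤ Real.log (Real.log (1 / (a k ^ 2 * Λ ^ 2))) := Real.log_nonneg hk
  have : 0 ≤ 2 * (betaCoeff₁ 0 / betaCoeff₀ 0) * Real.log (Real.log (1 / (a k ^ 2 * Λ ^ 2))) := by
    positivity
  linarith

/-- Hence an a.f. coupling sequence is eventually nonnegative (copy of Disproof §5). -/
theorem eventually_nonneg_of_af {a : ℕ → ℝ} (ha : ∀ k, 0 < a k)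
    (ha₀ : Tendsto a atTop (𝓝 0)) {β' : ℕ → ℝ} {Λ : ℝ} (hΛ : 0 < Λ)
    (hβ' : Tendsto (fun k => β' k - afBeta 0 Λ (a k)) atTop (𝓝 0)) :
    ∀ᶠ k in atTop, 0 ≤ β' k := by
  have h : Tendsto (fun k => (β' k - afBeta 0 Λ (a k)) + afBeta 0 Λ (a k)) atTop atTop :=
    hβ'.add_atTop (tendsto_afBeta_zero_atTop ha ha₀ hΛ)
  simp only [sub_add_cancel] at h
  exact h.eventually_ge_atTop 0

/-- A positive-time observable depends only on the links `P ∪ M` of the odd-torus RP theorem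
(copy of the landed `Negative.dependsOn_of_isPositiveTimeObservable`). -/
theorem dependsOn_of_isPositiveTimeObservable {d L' : ℕ} [NeZero d] [NeZero L'] {G : Type*} {α : Type*}
    {F : GaugeConfig d L' G → α} (hF : IsPositiveTimeObservable F) :
    DependsOn F ((WilsonOddRP.oPosEdges ∪ WilsonOddRP.oSharedEdges : Finset (Edge d L')) :
      Set (Edge d L')) := by
  intro U V hUV
  refine hF U V fun e h1 h2 _ _ => hUV e ?_
  rw [Finset.coe_union]
  exact Or.inl (Finset.mem_coe.2 (WilsonOddRP.mem_oPosEdges.2 (show WilsonOddRP.IsOPosEdge e from ⟨h1, h2⟩)))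

/-- `W ≡ 0` is reflection positive in D1's sense on every odd torus `2S+1`, `S ≥ 1`, `β ≥ 0`
(tree `wilsonExpectation_oddReflectionPositive`; copy of the landed `Negative.isReflectionPositive_zero_odd`). -/
theorem isReflectionPositive_zero_odd {S : ℕ} (hS : 1 ≤ S) {β : ℝ} (hβ : 0 ≤ β) (b : ℕ) :
    (0 : QuasiLocalGaugePerturbation 4 (2 * S + 1) SU3 b).IsReflectionPositive ρ₃ β := by
  intro F hF hFb hFpos
  rw [QuasiLocalGaugePerturbation.expectation_zero]
  exact wilsonExpectation_oddReflectionPositive ρ₃ ⟨S, by ring⟩ (by omega) (continuous_fundamentalRep _)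
    hβ F hF hFb (dependsOn_of_isPositiveTimeObservable hFpos)

/-- **`W ≡ 0` is admissible** at every step `k` with `β'_k ≥ 0` and `L_k ≥ 1`, for every `κ` and
every budget `η ≥ 0`: (h1) trivially, (h2) by odd-torus OS positivity, (h3) `‖0‖ = 0 ≤ η`, (h4)
vacuously. So every stub's `∀ W admissible` clause is exercised at least by the Wilson theory itself;
there the washing stubs are tautologies (`perturbedLatticeSchwinger_zero`, `connectedCorr_zero`). -/
theorem admAt_zero {κ η : ℝ} (hη : 0 ≤ η) {a : ℕ → ℝ} {L : ℕ → ℕ} {β' : ℕ → ℝ} {ℓ₀ : ℝ} {k : ℕ}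
    (hβ : 0 ≤ β' k) (hL : 1 ≤ L k) : AdmAt κ η a L β' ℓ₀ (fun _ _ => 0) k := by
  intro S hS
  refine ⟨fun v U => by simp, fun U => by simp, fun π U => by simp,
    isReflectionPositive_zero_odd (le_trans hL hS) hβ _, QuasiLocalGaugePerturbation.normLE_zero hη, ?_⟩
  rintro X - ⟨U, hU⟩
  simp at hU

/-- **The crux implies Stub 1** (`YMCore` is NECESSARY; no costume): apply the crux at `ℓ₀ = 1` to
`W ≡ 0` (admissible by `admAt_zero`) and identify the perturbed objects with the tree's
(`perturbedLatticeSchwinger_zero`, `connectedCorr_zero`). Same argument as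
`Disproof.robustYangMills_imp_wilson`. -/
theorem ymCore_of_robustYangMills (hR : RobustYangMills) : YMCore := by
  intro a L ha ha₀ haL β' Λ' hΛ' hβ'
  have hpos : ∀ᶠ k in atTop, 0 ≤ β' k := eventually_nonneg_of_af ha ha₀ hΛ' hβ'
  obtain ⟨η₀, hη₀, κ, -, h⟩ := hR
  have h1 := h a L ha ha₀ haL β' Λ' hΛ' hβ' 1 one_pos
  dsimp only at h1
  have hη : 0 ≤ η₀ / max 1 (afBeta 0 Λ' 1) :=
    div_nonneg hη₀.le (le_trans zero_le_one (le_max_left _ _))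
  have hL1 : ∀ᶠ k in atTop, 1 ≤ L k := by
    have h2 : ∀ᶠ k in atTop, (1 : ℝ) ≤ a k * L k := haL.eventually_ge_atTop 1
    have h3 : ∀ᶠ k in atTop, a k ≤ 1 := (ha₀.eventually (gt_mem_nhds one_pos)).mono fun k hk => hk.le
    filter_upwards [h2, h3] with k hk hk'
    by_contra hcon
    push Not at hcon
    have : L k = 0 := by omega
    rw [this] at hk
    simp at hk
    linarith
  have hadm : ∀ᶠ k in atTop, AdmAt κ (η₀ / max 1 (afBeta 0 Λ' 1)) a L β' 1 (fun _ _ => 0) k := by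
    filter_upwards [hpos, hL1] with k hk hkL
    exact admAt_zero hη hk hkL
  obtain ⟨φ, hφ, c, m, T, Δ, hΔ, hconv, hnt, hng, hgapT, hgapL, -⟩ := h1 (fun _ _ => 0) hadm
  refine ⟨φ, hφ, c, m, T, Δ, hΔ, fun n hn σ f F hF hF' => ?_, hnt, hng, hgapT, fun A B => ?_⟩
  · have := hconv n hn σ f F hF hF'
    refine this.congr fun j => ?_
    exact congrArg (fun r : ℝ => (r : ℂ))
      (perturbedLatticeSchwinger_zero ρ₃
        (⟨a, ha, ha₀, β', L, haL, c, m⟩ : SpeciesScheme (YMSpecies SU3))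
        (bs := fun k => ⌊(1 : ℝ) / a k⌋₊) (fun s => s.F) (φ j) n σ f)
  · obtain ⟨C, hC⟩ := hgapL A B
    refine ⟨C, ?_⟩
    filter_upwards [hC] with k hk S hS n hn
    have := hk S hS n hn
    rwa [QuasiLocalGaugePerturbation.connectedCorr_zero] at this

end NegativeChecks

end Summit.QuantumFields.QCD.Cruxes.RobustYangMills.CrossPlaneHankelRigidity

end
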